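import Literature.NumberTheory.Automorphic.PiOfArtinRepAtSigmaUnramifiedPlacesProofs
import Literature.NumberTheory.Automorphic.ArtinLFunctionsRankOneMatching
import HarnessLib

/-!
# Gelbart's Prop. 4.1 at the places where `σ` is unramified: the Artin side of the package and
the named fact from its automorphic half
(pure proofs; companion to `Automorphic/PiOfArtinRepAtSigmaUnramifiedPlaces` and
`Automorphic/PiOfArtinRepAtSigmaUnramifiedPlacesProofs`)

`eq_frobEigenvalues_of_global_functional_equations` (`PiOfArtinRepAtSigmaUnramifiedPlacesProofs`)
proves, at a finite place `v` where the Artin representation `σ : Γ_F → GL₂(ℂ)` is unramified with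
Frobenius eigenvalues `A`, that the inverse roots `B` of the local factor of `π` at `v` equal `A`
("`L(s, π_v) = L(s, σ_v)`", Jacquet–Langlands 1970, proof of Thm. 12.2, pp. 209–211) from a
*global analytic package*: four functions (the completed twisted L-functions of `π`, `σ` and of
their contragredients) with functional equations and Euler-factor agreements off `v`.  Here the
`σ`-half of the package is **instantiated from the tree**: Artin's functional equation
`Λ(1 - s, ρ) = W Λ(s, ρ^∨)` for framed Artin representations of number fields is the named fact
`artin_functional_equation` (Neukirch VII (12.6)), which is a **theorem**
(`artin_functional_equation_holds`, `Automorphic/ArtinLFunctionsRankOneMatching`).  So the named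
fact `frobSatakeCompatibleAt_of_isPiOfArtinRep_of_isUnramifiedAt` (Gelbart 1997, Prop. 4.1, the
shadow at the places where `σ` is unramified) follows from the **automorphic half alone**:

* `eq_frobEigenvalues_of_satisfiesFunctionalEquation` — `B = A` from
  `ArtinRep.SatisfiesFunctionalEquation ρ ρ^∨` and the automorphic half relative to `ρ`
  (meromorphic `Λ_π, Λ_π'`, `Λ_π(s) = ε_π(s) Λ_π'(1 - s)`, entire reciprocal archimedean factors,
  Euler-factor agreements with `L(s, ρ) L_v(ρ, q^{-s})` and `L(s, ρ^∨) L_v(ρ^∨, q^{-s})` on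
  `re s > c ≥ 1`); mirror of `frobSatake_of_satisfiesFunctionalEquation`
  (`StrongArtinGL2ArtinSideProofs`).
* `isUnramifiedAt_and_hasFrobCharpolyAt_twist` — a twist by a character trivial on inertia and
  Frobenius above `v` (the Galois avatar of `ω`, `ω_v = 1`) does not change the local data at `v`
  (converse direction of `isUnramifiedAt_and_hasFrobCharpolyAt_of_twist`).
* `frobSatakeCompatibleAt_of_isPiOfArtinRep_of_isUnramifiedAt_of_automorphicHalf` — **the named
  fact from its automorphic half**, displayed inline as the hypothesis `H`: for cuspidal
  `π = π(σ)` and `v` with `σ` unramified at `v` there are `χ : Γ_F → ℂˣ` trivial on inertia and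
  Frobenius above `v` (Lemma 12.5, in finite order via Chevalley 1951), multisets `B, B'` with
  `card B ≤ 2` (the inverse roots of `L(s, π_v)⁻¹`, `L(s, π̃_v)⁻¹`; Jacquet–Langlands Thm. 2.18,
  Props. 3.5–3.6), meromorphic `Λ_π, Λ_π'` with a functional equation
  `Λ_π(s) = ε_π(s) Λ_π'(1 - s)` (Thm. 11.1, Cor. 11.2), entire reciprocal archimedean factors (`Γ_π`
  vanishing on finitely many horizontal lines), the Euler-factor agreements with `L(s, σ ⊗ χ)`,
  `L(s, (σ ⊗ χ)^∨)` off `v` (`π = π(σ)` at the unramified places, local factors `1` at the other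
  exceptional places by Lemma 12.5 and Prop. 3.8), **and the unramified dictionary**
  `card B = 2 → π.HasSatakeParamAt v B` (a local factor of degree two at `v` means
  `π_v = π(μ₁, μ₂)` with `μᵢ` unramified, Thm. 2.18 and Props. 3.5–3.6, i.e. `π_v` is spherical with
  Satake parameter `{μ₁(ϖ), μ₂(ϖ)} = B`: Gelbart Example 3.2.3, Borel–Jacquet 1979 4.6, Flath 1979
  Thm. 3).  Given `H`, the fact follows: `B = A`, so `card B = 2`, so `π` has Satake parameter
  `A` at `v`, which is `FrobSatakeCompatibleAt σ π v`.
* `frobSatakeCompatibleAt_of_isPiOfArtinRep_both_of_uniformAutomorphicPackage` — **both shadows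
  of Prop. 4.1 from ONE package**: the same data at an *arbitrary* finite place `v`, with the two
  unramified computations (`π` with Satake parameter `α` at `v` ⇒ `B = α`, `B' = {a⁻¹}`; and
  `card B = 2 ⇒ π` has Satake parameter `B`), displayed as `U`, implies the conjunction of
  `frobSatakeCompatibleAt_of_isPiOfArtinRep` and
  `frobSatakeCompatibleAt_of_isPiOfArtinRep_of_isUnramifiedAt` (via
  `frobSatakeCompatibleAt_of_isPiOfArtinRep_of_artinFE` and the theorem above) — so a single
  named fact for `U` would discharge the companion fact and this one.

What is deliberately NOT here (absent from the tree, and not introduced as named facts, D-0026):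
the automorphic half `H` — Hecke theory for the cuspidal Borel–Jacquet datum
`CuspidalAutomorphicRepData` twisted by idèle class characters, with its local factors at the
ramified places of `π`, and the unramified dictionary.  No new definition and no named fact is
introduced.

## References

* S. Gelbart, *Three lectures on the modularity of `ρ̄_{E,3}` and the Langlands reciprocity
  conjecture*, in *Modular Forms and Fermat's Last Theorem* (1997): Prop. 4.1 (p. 236 of the
  volume), Thm. 3.2, Example 3.2.3. [Gelbart1997]
* H. Jacquet, R. P. Langlands, *Automorphic Forms on GL(2)*, LNM 114 (1970): Thm. 2.18,
  Props. 3.5, 3.6, 3.8, Thm. 11.1, Cor. 11.2, Lemma 12.5, proof of Thm. 12.2 (pp. 209–211,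
  retypeset ed.). [JacquetLanglands1970]
* R. P. Langlands, *Base Change for GL(2)*, Ann. of Math. Studies 96 (1980), §3, pp. 23–24.
  [LanglandsBaseChange1980]
* J. Neukirch, *Algebraic Number Theory* (1999), VII §12 Thm. (12.6). [NeukirchANT1999]
* C. Chevalley, *Deux théorèmes d'arithmétique*, J. Math. Soc. Japan 3 (1951), Thm. 1 (finite-index
  subgroups of finitely generated subgroups of `F^×` are congruence subgroups).
* A. Borel, H. Jacquet, *Automorphic forms and automorphic representations*, Corvallis (1979), 4.6;
  D. Flath, *Decomposition of representations into tensor products*, Corvallis (1979), Thm. 3.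
-/

noncomputable section

open scoped MatrixGroups NumberField Polynomial
open NumberField IsDedekindDomain Field Polynomial Complex Filter Topology Set
open Literature.NumberTheory.GaloisRepresentations (ArtinRep FramedArtinRep)
open Literature.NumberTheory.LFunctions

namespace Literature.NumberTheory.Automorphic

/-! ### The Artin side of the package, from `artin_functional_equation` -/

section ArtinSide

variable {F : Type} [Field F] [NumberField F]

/-- **`L(s, π_v) = L(s, σ_v)` at a `σ`-unramified place from Artin's functional equation and the
automorphic half of the package** (Jacquet–Langlands 1970, pp. 209–211, with the Artin side
instantiated from the tree).  Let `ρ : Γ_F → GL₂(ℂ)` be unramified at `v` with Frobenius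
eigenvalues `A`, and suppose `ρ` and its contragredient `ρ^∨ = (ρᵀ)⁻¹` (`FramedRep.dual`) satisfy
Artin's functional equation in the tree's sense (`ArtinRep.SatisfiesFunctionalEquation ρ ρ^∨`:
meromorphic `Λ, Λ'` continuing `Λ(s, ρ) = A(ρ)^{s/2} γ(ρ, s) L(s, ρ)` and `Λ(s, ρ^∨)` from
`re s > 1`, `Λ(1 - s) = W Λ'(s)`, `|W| = 1` — the instance at `ρ` of `artin_functional_equation`,
a theorem of the tree, `artin_functional_equation_holds`).  Suppose given the **automorphic half**
relative to `ρ`: multisets `B` (`card B ≤ 2`) and `B'`, meromorphic `Λ_π, Λ_π'` with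
`Λ_π(s) = ε_π(s) Λ_π'(1 - s)` (`ε_π` continuous, nowhere zero), entire `Γ_π, Γ_π'` with `Γ_π`
vanishing only on finitely many horizontal lines, `c ≥ 1`, such that for `re s > c`
`Λ_π(s) ∏_{b ∈ B} (1 - b q^{-s}) Γ_π(s) = L(s, ρ) L_v(ρ, q^{-s})` and
`Λ_π'(s) ∏_{b ∈ B'} (1 - b q^{-s}) Γ_π'(s) = L(s, ρ^∨) L_v(ρ^∨, q^{-s})`
(`L(s, ·) = artinLFunction`, `L_v(·, T) = ArtinRep.eulerFactorAt`, the Euler *polynomial*).  Then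
`B = A`.  Proof: as `frobSatake_of_satisfiesFunctionalEquation` —
`eq_frobEigenvalues_of_global_functional_equations` for `(ρ, ρ^∨)` with `Λ_σ = Λ`, `Λ_σ' = Λ'`,
`ε_σ = W`, `Γ_σ(s) = A(ρ)^{-s/2} γ(ρ, s)⁻¹`, `Γ_σ'(s) = A(ρ^∨)^{-s/2} γ(ρ^∨, s)⁻¹`
(`ArtinRep.exists_gammaFactor_inv`: entire, real zeros), the common exceptional set of the four
meromorphic functions (`exists_isClosed_countable_analyticAt`), and `Λ_π' ≢ 0` off it because
`L(s, ρ^∨) L_v(ρ^∨, q^{-s}) ≠ 0` for `re s > 1`.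
[cite: JacquetLanglands1970, proof of Thm. 12.2, pp. 209–211]
[cite: NeukirchANT1999, VII §12, Thm. (12.6)] -/
theorem eq_frobEigenvalues_of_satisfiesFunctionalEquation (ρ : FramedArtinRep F 2)
    (v : HeightOneSpectrum (𝓞 F)) {A : Multiset ℂ} (hcard : Multiset.card A = 2)
    (hur : ρ.IsUnramifiedAt v) (hchar : ρ.HasFrobCharpolyAt v (satakePolynomial A))
    (hFE : ρ.toArtinRep.SatisfiesFunctionalEquation
      (FramedArtinRep.toArtinRep (GaloisRepresentations.FramedRep.dual ρ)))
    {B B' : Multiset ℂ} (hB : Multiset.card B ≤ 2)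
    {Λπ Λπ' : ℂ → ℂ} (hΛπ : Meromorphic Λπ) (hΛπ' : Meromorphic Λπ')
    {Γπ Γπ' επ : ℂ → ℂ} (hΓπ : Differentiable ℂ Γπ) (hΓπ' : Differentiable ℂ Γπ')
    (hYπ : ∃ Y : Set ℝ, Y.Finite ∧ ∀ s, Γπ s = 0 → s.im ∈ Y)
    (hεπ : Continuous επ) (hεπ0 : ∀ s, επ s ≠ 0) {c : ℝ} (hc : 1 ≤ c)
    (hEπ : ∀ s : ℂ, c < s.re →
      Λπ s * ((B.map fun b => eulerTerm v.residueCard b s).prod * Γπ s) =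
        GaloisRepresentations.artinLFunction ρ.toArtinRep s *
          (ρ.toArtinRep.eulerFactorAt v).eval ((v.residueCard : ℂ) ^ (-s)))
    (hEπ' : ∀ s : ℂ, c < s.re →
      Λπ' s * ((B'.map fun b => eulerTerm v.residueCard b s).prod * Γπ' s) =
        GaloisRepresentations.artinLFunction
            (FramedArtinRep.toArtinRep (GaloisRepresentations.FramedRep.dual ρ)) s *
          ((FramedArtinRep.toArtinRep
            (GaloisRepresentations.FramedRep.dual ρ)).eulerFactorAt v).eval
            ((v.residueCard : ℂ) ^ (-s)))
    (hFπ : ∀ s, Λπ s = επ s * Λπ' (1 - s)) :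
    B = A := by
  set ρ' : FramedArtinRep F 2 := GaloisRepresentations.FramedRep.dual ρ with hρ'
  obtain ⟨Λ, Λ', hΛ, hΛ', hagree, W, hW1, hW⟩ := hFE
  -- the reciprocal completed factors of `ρ` and `ρ^∨`
  obtain ⟨γi, hγid, hγi, hγi0⟩ := ρ.toArtinRep.exists_gammaFactor_inv
  obtain ⟨γi', hγi'd, hγi', hγi'0⟩ := ρ'.toArtinRep.exists_gammaFactor_inv
  have hA : (ρ.toArtinRep.artinConductorNorm : ℂ) ≠ 0 :=
    Nat.cast_ne_zero.2 ρ.toArtinRep.artinConductorNorm_ne_zero'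
  have hA' : (ρ'.toArtinRep.artinConductorNorm : ℂ) ≠ 0 :=
    Nat.cast_ne_zero.2 ρ'.toArtinRep.artinConductorNorm_ne_zero'
  have hpowd : ∀ {A : ℂ}, A ≠ 0 → Differentiable ℂ fun s : ℂ => A ^ (-(s / 2)) := fun hA s =>
    DifferentiableAt.const_cpow ((differentiableAt_id.div_const 2).neg) (Or.inl hA)
  have hpow0 : ∀ {A : ℂ}, A ≠ 0 → ∀ s : ℂ, A ^ (-(s / 2)) ≠ 0 := fun hA s h =>
    hA ((cpow_eq_zero_iff _ _).1 h).1
  have hpow1 : ∀ {A : ℂ}, A ≠ 0 → ∀ s : ℂ, A ^ (s / 2) * A ^ (-(s / 2)) = 1 := fun hA s => by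
    rw [cpow_neg, mul_inv_cancel₀ fun h => hA ((cpow_eq_zero_iff _ _).1 h).1]
  -- the common exceptional set
  obtain ⟨P, hPc, hP, hPs, hPa⟩ := exists_isClosed_countable_analyticAt hΛπ hΛ hΛπ' hΛ'
  -- `Λ_π' ≢ 0` off `P`: `L(s, ρ^∨) L_v(ρ^∨, q^{-s}) ≠ 0` for `re s > 1`
  have hNV' : ∃ s, s ∉ P ∧ Λπ' s ≠ 0 := by
    obtain ⟨s, hsc, hsP⟩ := (Set.Countable.dense_compl ℂ hP).inter_open_nonempty
      {s : ℂ | c < s.re} (isOpen_lt continuous_const Complex.continuous_re)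
      ⟨((c + 1 : ℝ) : ℂ), by simp⟩
    have hsc : c < s.re := hsc
    have hne : Λπ' s * ((B'.map fun b => eulerTerm v.residueCard b s).prod * Γπ' s) ≠ 0 := by
      rw [hEπ' s hsc]
      exact mul_ne_zero
        (GaloisRepresentations.artinLFunction_ne_zero_of_one_lt_re ρ'.toArtinRep (by linarith))
        (ρ'.toArtinRep.eval_eulerFactorAt_ne_zero v (by linarith))
    exact ⟨s, hsP, left_ne_zero_of_mul hne⟩
  have hd : ∀ {f : ℂ → ℂ}, (∀ s, s ∉ P → AnalyticAt ℂ f s) → DifferentiableOn ℂ f Pᶜ :=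
    fun h s hs => (h s hs).differentiableAt.differentiableWithinAt
  refine eq_frobEigenvalues_of_global_functional_equations ρ ρ' v hcard hur hchar (B' := B') hB
    hPc hP hPs (hd fun s hs => (hPa s hs).1) (hd fun s hs => (hPa s hs).2.1)
    (hd fun s hs => (hPa s hs).2.2.1) (hd fun s hs => (hPa s hs).2.2.2)
    (Γσ := fun s => (ρ.toArtinRep.artinConductorNorm : ℂ) ^ (-(s / 2)) * γi s)
    (Γσ' := fun s => (ρ'.toArtinRep.artinConductorNorm : ℂ) ^ (-(s / 2)) * γi' s)
    (εσ := fun _ => W)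
    hΓπ ((hpowd hA).mul hγid) hΓπ' ((hpowd hA').mul hγi'd) hεπ continuous_const hεπ0 hYπ
    ⟨{0}, Set.finite_singleton 0, fun s hs =>
      hγi'0 s ((mul_eq_zero.mp hs).resolve_left (hpow0 hA' s))⟩
    (c := c) (fun s hs _ => ?_) (fun s hs _ => ?_) (fun s _ => hFπ s) (fun s _ => ?_) hNV'
  · -- `Λ(s) L_v(ρ, q^{-s}) Γ_σ(s) = L(s, ρ) L_v(ρ, q^{-s})` on `re s > 1`
    have hs1 : 1 < s.re := by linarith
    have hs0 : 0 < s.re := by linarith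
    have key : (ρ.toArtinRep.artinConductorNorm : ℂ) ^ (s / 2) * ρ.toArtinRep.gammaFactor s *
        ((ρ.toArtinRep.artinConductorNorm : ℂ) ^ (-(s / 2)) * γi s) = 1 := by
      calc (ρ.toArtinRep.artinConductorNorm : ℂ) ^ (s / 2) * ρ.toArtinRep.gammaFactor s *
            ((ρ.toArtinRep.artinConductorNorm : ℂ) ^ (-(s / 2)) * γi s)
          = ((ρ.toArtinRep.artinConductorNorm : ℂ) ^ (s / 2) *
              (ρ.toArtinRep.artinConductorNorm : ℂ) ^ (-(s / 2))) *
              (ρ.toArtinRep.gammaFactor s * γi s) := by ring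
        _ = 1 := by rw [hpow1 hA s, hγi s hs0, one_mul]
    rw [hEπ s hs, (hagree s hs1).1, GaloisRepresentations.completedArtinLFunction]
    linear_combination (-(GaloisRepresentations.artinLFunction ρ.toArtinRep s *
      (ρ.toArtinRep.eulerFactorAt v).eval ((v.residueCard : ℂ) ^ (-s)))) * key
  · -- the same for `ρ^∨`
    have hs1 : 1 < s.re := by linarith
    have hs0 : 0 < s.re := by linarith
    have key : (ρ'.toArtinRep.artinConductorNorm : ℂ) ^ (s / 2) * ρ'.toArtinRep.gammaFactor s *
        ((ρ'.toArtinRep.artinConductorNorm : ℂ) ^ (-(s / 2)) * γi' s) = 1 := by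
      calc (ρ'.toArtinRep.artinConductorNorm : ℂ) ^ (s / 2) * ρ'.toArtinRep.gammaFactor s *
            ((ρ'.toArtinRep.artinConductorNorm : ℂ) ^ (-(s / 2)) * γi' s)
          = ((ρ'.toArtinRep.artinConductorNorm : ℂ) ^ (s / 2) *
              (ρ'.toArtinRep.artinConductorNorm : ℂ) ^ (-(s / 2))) *
              (ρ'.toArtinRep.gammaFactor s * γi' s) := by ring
        _ = 1 := by rw [hpow1 hA' s, hγi' s hs0, one_mul]
    rw [hEπ' s hs, (hagree s hs1).2, GaloisRepresentations.completedArtinLFunction]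
    linear_combination (-(GaloisRepresentations.artinLFunction ρ'.toArtinRep s *
      (ρ'.toArtinRep.eulerFactorAt v).eval ((v.residueCard : ℂ) ^ (-s)))) * key
  · -- the functional equation `Λ(s) = W Λ'(1 - s)`
    have h := hW (1 - s)
    rwa [sub_sub_cancel] at h

/-! ### Twists trivial at `v` -/

omit [NumberField F] in
/-- **A twist by a character trivial on the decomposition data at `v` does not change the local
behaviour at `v`** (converse direction of `isUnramifiedAt_and_hasFrobCharpolyAt_of_twist`).  If
`χ : Γ_F → ℂˣ` is trivial on the inertia groups `I_𝔓` and on the arithmetic Frobenius elements at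
every `𝔓 ∣ v`, then `σ` unramified at `v` with `charpoly σ(Frob_v) = P` implies the same for
`σ ⊗ χ` (`FramedRep.twist_apply_of_eq_one`).  This is the situation of Jacquet–Langlands 1970,
p. 210, where the idèle class character `ω` is chosen with `ω_v = 1` (Lemma 12.5). [folklore] -/
theorem isUnramifiedAt_and_hasFrobCharpolyAt_twist {n : ℕ} (σ : FramedArtinRep F n)
    (χ : absoluteGaloisGroup F →ₜ* ℂˣ) (v : HeightOneSpectrum (𝓞 F)) (P : ℂ[X])
    (hχI : ∀ 𝔓 ∈ v.primesAbove, ∀ g ∈ 𝔓.inertia (absoluteGaloisGroup F), χ g = 1)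
    (hχF : ∀ 𝔓 ∈ v.primesAbove, ∀ g : absoluteGaloisGroup F, IsArithFrobAt (𝓞 F) g 𝔓 → χ g = 1)
    (h : σ.IsUnramifiedAt v ∧ σ.HasFrobCharpolyAt v P) :
    GaloisRepresentations.FramedGaloisRep.IsUnramifiedAt v
        (GaloisRepresentations.FramedRep.twist σ χ) ∧
      GaloisRepresentations.FramedGaloisRep.HasFrobCharpolyAt v P
        (GaloisRepresentations.FramedRep.twist σ χ) := by
  refine ⟨fun 𝔓 h𝔓 g hg => ?_, fun 𝔓 h𝔓 g hg => ?_⟩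
  · rw [GaloisRepresentations.FramedRep.twist_apply_of_eq_one σ χ (hχI 𝔓 h𝔓 g hg)]
    exact h.1 𝔓 h𝔓 g hg
  · have h2 := h.2 𝔓 h𝔓 g hg
    unfold GaloisRepresentations.FramedRep.charpoly at h2 ⊢
    rwa [GaloisRepresentations.FramedRep.twist_apply_of_eq_one σ χ (hχF 𝔓 h𝔓 g hg)]

end ArtinSide

/-! ### The named fact from its automorphic half -/

section NamedFact

open scoped Classical

/-- **Gelbart's Prop. 4.1 at the `σ`-unramified places from the automorphic half of its printed
proof.**  The named fact `frobSatakeCompatibleAt_of_isPiOfArtinRep_of_isUnramifiedAt` follows from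
the statement — displayed inline as the hypothesis `H`, which is what Jacquet–Langlands 1970
provide for a cuspidal automorphic representation `π` of `GL₂(𝔸_F)` and which the tree does not
have for the Borel–Jacquet datum `CuspidalAutomorphicRepData` — that whenever the cuspidal
`π = π(σ)` (`IsPiOfArtinRep σ π`) and `σ` is unramified at the finite place `v` (`q = N v`), there
are: a continuous character `χ : Γ_F → ℂˣ` trivial on the inertia groups and on the Frobenius
elements above `v` (the Galois avatar of an idèle class character `ω` of finite order with
`ω_v = 1`, so ramified at the other exceptional finite places that all local factors of `ω ⊗ π` and
`ω ⊗ σ` there are `1` — Lemma 12.5 with Prop. 3.8; `ω` can be taken of finite order, at the price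
of extra ramification at finitely many *compatible* places, where both local factors are again `1`,
by Chevalley's congruence theorem for the `{v}`-units, *Deux théorèmes d'arithmétique* (1951),
Thm. 1); multisets `B`, `B'` with `card B ≤ 2` — the inverse roots of
`L(s, ω_v ⊗ π_v)⁻¹ = L(s, π_v)⁻¹` and of `L(s, ω_v⁻¹ ⊗ π̃_v)⁻¹`, Euler polynomials of degree `≤ 2`
for the infinite-dimensional `π_v` (Thm. 2.18, Props. 3.5–3.6); meromorphic `Λ_π, Λ_π'` (the
completed `L(s, ω ⊗ π)`, `L(s, ω⁻¹ ⊗ π̃)`) with the functional equation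
`Λ_π(s) = ε_π(s) Λ_π'(1 - s)`, `ε_π` continuous and nowhere zero (Thm. 11.1, Cor. 11.2); entire
reciprocal archimedean factors `Γ_π, Γ_π'`, `Γ_π` vanishing only on finitely many horizontal lines
(as finite products of `Γ_ℝ(s + m)⁻¹` do); `c ≥ 1`; the Euler-factor agreements
`Λ_π(s) ∏_{b ∈ B}(1 - b q^{-s}) Γ_π(s) = L(s, σ ⊗ χ) L_v(σ ⊗ χ, q^{-s})` and
`Λ_π'(s) ∏_{b ∈ B'}(1 - b q^{-s}) Γ_π'(s) = L(s, (σ ⊗ χ)^∨) L_v((σ ⊗ χ)^∨, q^{-s})` on `re s > c`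
(all finite local factors of `ω ⊗ π` and `ω ⊗ σ` away from `v` agree: at the unramified places
because `π = π(σ)`, at the other exceptional places because both are `1`); **and the unramified
dictionary at `v`**: if `card B = 2`, i.e. `L(s, π_v)` has degree two, then `π` has Satake parameter
`B` at `v` (`π_v = π(μ₁, μ₂)` with `μ₁, μ₂` unramified by Thm. 2.18 and Props. 3.5–3.6, so `π_v`
is spherical with `t_{π_v} = diag(μ₁(ϖ), μ₂(ϖ))`: Gelbart 1997, Example 3.2.3 and Thm. 3.2;
Borel–Jacquet 1979, 4.6; Flath 1979, Thm. 3).  `H` is a true statement about cuspidal automorphic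
representations of `GL₂` (it follows from the results just cited), not a restatement of the fact:
it says nothing about the Frobenius of `σ` at `v`.  Given `H`: the Frobenius eigenvalues `A` of
`σ` at `v` are those of `σ ⊗ χ` (`isUnramifiedAt_and_hasFrobCharpolyAt_twist`), Artin's functional
equation holds for `σ ⊗ χ` (`artin_functional_equation_holds`), so `B = A`
(`eq_frobEigenvalues_of_satisfiesFunctionalEquation`), `card B = 2`, and `π` has Satake parameter
`A` at `v` — which is `FrobSatakeCompatibleAt σ π v`.
[cite: Gelbart1997, Prop. 4.1 (with Thm. 3.2 and Example 3.2.3)]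
[cite: JacquetLanglands1970, proof of Thm. 12.2 pp. 209–211, Thm. 11.1, Cor. 11.2, Lemma 12.5] -/
theorem frobSatakeCompatibleAt_of_isPiOfArtinRep_of_isUnramifiedAt_of_automorphicHalf
    (H : ∀ {F : Type} [Field F] [NumberField F] (hcpt : isCompact_glFiniteIntegralLevel 2 F)
      (σ : FramedArtinRep F 2) (π : CuspidalAutomorphicRepData 2 F hcpt),
      IsPiOfArtinRep σ π.1 → ∀ v : HeightOneSpectrum (𝓞 F), σ.IsUnramifiedAt v →
        ∃ (χ : absoluteGaloisGroup F →ₜ* ℂˣ) (B B' : Multiset ℂ) (Λπ Λπ' Γπ Γπ' επ : ℂ → ℂ)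
          (c : ℝ),
          (∀ 𝔓 ∈ v.primesAbove, ∀ g ∈ 𝔓.inertia (absoluteGaloisGroup F), χ g = 1) ∧
          (∀ 𝔓 ∈ v.primesAbove, ∀ g : absoluteGaloisGroup F,
            IsArithFrobAt (𝓞 F) g 𝔓 → χ g = 1) ∧
          Multiset.card B ≤ 2 ∧
          Meromorphic Λπ ∧ Meromorphic Λπ' ∧ Differentiable ℂ Γπ ∧ Differentiable ℂ Γπ' ∧
          (∃ Y : Set ℝ, Y.Finite ∧ ∀ s, Γπ s = 0 → s.im ∈ Y) ∧
          Continuous επ ∧ (∀ s, επ s ≠ 0) ∧ 1 ≤ c ∧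
          (∀ s : ℂ, c < s.re →
            Λπ s * ((B.map fun b => eulerTerm v.residueCard b s).prod * Γπ s) =
              GaloisRepresentations.artinLFunction
                  (FramedArtinRep.toArtinRep (GaloisRepresentations.FramedRep.twist σ χ)) s *
                ((FramedArtinRep.toArtinRep
                  (GaloisRepresentations.FramedRep.twist σ χ)).eulerFactorAt v).eval
                  ((v.residueCard : ℂ) ^ (-s))) ∧
          (∀ s : ℂ, c < s.re →
            Λπ' s * ((B'.map fun b => eulerTerm v.residueCard b s).prod * Γπ' s) =
              GaloisRepresentations.artinLFunction
                  (FramedArtinRep.toArtinRep (GaloisRepresentations.FramedRep.dual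
                    (GaloisRepresentations.FramedRep.twist σ χ))) s *
                ((FramedArtinRep.toArtinRep (GaloisRepresentations.FramedRep.dual
                  (GaloisRepresentations.FramedRep.twist σ χ))).eulerFactorAt v).eval
                  ((v.residueCard : ℂ) ^ (-s))) ∧
          (∀ s, Λπ s = επ s * Λπ' (1 - s)) ∧
          (Multiset.card B = 2 → π.1.HasSatakeParamAt v B)) :
    frobSatakeCompatibleAt_of_isPiOfArtinRep_of_isUnramifiedAt := by
  intro F _ _ hcpt σ π hπ v hv
  obtain ⟨χ, B, B', Λπ, Λπ', Γπ, Γπ', επ, c, hχI, hχF, hB, hΛπ, hΛπ', hΓπ, hΓπ', hYπ, hεπ, hεπ0,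
    hc, hEπ, hEπ', hFπ, hdict⟩ := H hcpt σ π hπ v hv
  -- the Frobenius eigenvalues of `σ` at `v`, and of `σ ⊗ χ`
  obtain ⟨A, hcard, -, hchar⟩ := FramedArtinRep.exists_frobEigenvalues_of_isUnramifiedAt σ hv
  obtain ⟨hurρ, hcharρ⟩ := isUnramifiedAt_and_hasFrobCharpolyAt_twist σ χ v _ hχI hχF ⟨hv, hchar⟩
  -- `L(s, π_v) = L(s, σ_v)`: `B = A`
  have hBA : B = A :=
    eq_frobEigenvalues_of_satisfiesFunctionalEquation (GaloisRepresentations.FramedRep.twist σ χ) v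
      hcard hurρ hcharρ (artin_functional_equation_holds _) hB hΛπ hΛπ' hΓπ hΓπ' hYπ hεπ hεπ0 hc
      hEπ hEπ' hFπ
  subst hBA
  exact ⟨B, hdict hcard, hv, hchar⟩

/-! ### Both shadows of Prop. 4.1 from one automorphic package -/

/-- **Gelbart's Prop. 4.1 — both unramified shadows — from ONE automorphic package.**  The two
named facts `frobSatakeCompatibleAt_of_isPiOfArtinRep` (the shadow at the places where `π` is
unramified, `StrongArtinGL2`) and `frobSatakeCompatibleAt_of_isPiOfArtinRep_of_isUnramifiedAt` (the
shadow at the places where `σ` is unramified, `PiOfArtinRepAtSigmaUnramifiedPlaces`) follow from a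
single statement about cuspidal automorphic representations of `GL₂(𝔸_F)` — displayed inline as
the hypothesis `U`; it is the twisted Hecke theory of Jacquet–Langlands 1970 at an **arbitrary**
finite place `v` (Thm. 11.1, Cor. 11.2, Lemma 12.5, Thm. 2.18, Props. 3.5–3.6, 3.8) together with
the unramified computations (Example 3.2.3 of Gelbart 1997 / Borel–Jacquet 1979, 4.6): for cuspidal
`π = π(σ)` and every finite `v` there are `χ` trivial on inertia and Frobenius above `v`, the
inverse roots `B` (`card B ≤ 2`), `B'` of the local factors of `π`, `π̃` at `v`, the automorphic
half of the analytic package relative to `σ ⊗ χ` (as in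
`frobSatakeCompatibleAt_of_isPiOfArtinRep_of_isUnramifiedAt_of_automorphicHalf`, with both
reciprocal archimedean factors vanishing only on finitely many horizontal lines), and the two
unramified computations at `v`: if `π` has Satake parameter `α` at `v` then `B = α` and
`B' = {a⁻¹ : a ∈ α}` (the local factors of an unramified `π_v` and of `π̃_v`), and if `card B = 2`
then `π` has Satake parameter `B` at `v`.  Given `U`: at a place where `π` has Satake parameter
`α`, `U` specialises to the hypothesis of `frobSatakeCompatibleAt_of_isPiOfArtinRep_of_artinFE`
(with Artin's functional equation supplied by `artin_functional_equation_holds`); at a place where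
`σ` is unramified, to the hypothesis `H` above.  So one named fact for `U` would discharge both
shadows (D-0026: none is introduced here).
[cite: Gelbart1997, Prop. 4.1 (with Thm. 3.2 and Example 3.2.3)]
[cite: JacquetLanglands1970, proof of Thm. 12.2 pp. 209–211, Thm. 11.1, Cor. 11.2, Lemma 12.5] -/
theorem frobSatakeCompatibleAt_of_isPiOfArtinRep_both_of_uniformAutomorphicPackage
    (U : ∀ {F : Type} [Field F] [NumberField F] (hcpt : isCompact_glFiniteIntegralLevel 2 F)
      (σ : FramedArtinRep F 2) (π : CuspidalAutomorphicRepData 2 F hcpt),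
      IsPiOfArtinRep σ π.1 → ∀ v : HeightOneSpectrum (𝓞 F),
        ∃ (χ : absoluteGaloisGroup F →ₜ* ℂˣ) (B B' : Multiset ℂ) (Λπ Λπ' Γπ Γπ' επ : ℂ → ℂ)
          (c : ℝ),
          (∀ 𝔓 ∈ v.primesAbove, ∀ g ∈ 𝔓.inertia (absoluteGaloisGroup F), χ g = 1) ∧
          (∀ 𝔓 ∈ v.primesAbove, ∀ g : absoluteGaloisGroup F,
            IsArithFrobAt (𝓞 F) g 𝔓 → χ g = 1) ∧
          Multiset.card B ≤ 2 ∧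
          Meromorphic Λπ ∧ Meromorphic Λπ' ∧ Differentiable ℂ Γπ ∧ Differentiable ℂ Γπ' ∧
          (∃ Y : Set ℝ, Y.Finite ∧ ∀ s, Γπ s = 0 → s.im ∈ Y) ∧
          (∃ Y : Set ℝ, Y.Finite ∧ ∀ s, Γπ' s = 0 → s.im ∈ Y) ∧
          Continuous επ ∧ (∀ s, επ s ≠ 0) ∧ 1 ≤ c ∧
          (∀ s : ℂ, c < s.re →
            Λπ s * ((B.map fun b => eulerTerm v.residueCard b s).prod * Γπ s) =
              GaloisRepresentations.artinLFunction
                  (FramedArtinRep.toArtinRep (GaloisRepresentations.FramedRep.twist σ χ)) s *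
                ((FramedArtinRep.toArtinRep
                  (GaloisRepresentations.FramedRep.twist σ χ)).eulerFactorAt v).eval
                  ((v.residueCard : ℂ) ^ (-s))) ∧
          (∀ s : ℂ, c < s.re →
            Λπ' s * ((B'.map fun b => eulerTerm v.residueCard b s).prod * Γπ' s) =
              GaloisRepresentations.artinLFunction
                  (FramedArtinRep.toArtinRep (GaloisRepresentations.FramedRep.dual
                    (GaloisRepresentations.FramedRep.twist σ χ))) s *
                ((FramedArtinRep.toArtinRep (GaloisRepresentations.FramedRep.dual
                  (GaloisRepresentations.FramedRep.twist σ χ))).eulerFactorAt v).eval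
                  ((v.residueCard : ℂ) ^ (-s))) ∧
          (∀ s, Λπ s = επ s * Λπ' (1 - s)) ∧
          (∀ α : Multiset ℂ, π.1.HasSatakeParamAt v α → B = α ∧ B' = α.map fun a => a⁻¹) ∧
          (Multiset.card B = 2 → π.1.HasSatakeParamAt v B)) :
    frobSatakeCompatibleAt_of_isPiOfArtinRep ∧
      frobSatakeCompatibleAt_of_isPiOfArtinRep_of_isUnramifiedAt := by
  constructor
  · -- the `π`-unramified shadow: `U` at a place where `π` has Satake parameter `α`
    refine frobSatakeCompatibleAt_of_isPiOfArtinRep_of_artinFE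
      (fun F _ _ => artin_functional_equation_holds) fun hcpt σ π hπ v α hα => ?_
    obtain ⟨χ, B, B', Λπ, Λπ', Γπ, Γπ', επ, c, hχI, hχF, -, hΛπ, hΛπ', hΓπ, hΓπ', hYπ, hYπ',
      hεπ, hεπ0, hc, hEπ, hEπ', hFπ, hunr, -⟩ := U hcpt σ π hπ v
    obtain ⟨rfl, rfl⟩ := hunr α hα
    refine ⟨χ, Λπ, Λπ', Γπ, Γπ', επ, c, hχI, hχF, hΛπ, hΛπ', hΓπ, hΓπ', hYπ, hYπ', hεπ, hεπ0,
      hc, hEπ, fun s hs => ?_, hFπ⟩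
    rw [← hEπ' s hs, Multiset.map_map]
    rfl
  · -- the `σ`-unramified shadow: `U` is (more than) the hypothesis `H`
    refine frobSatakeCompatibleAt_of_isPiOfArtinRep_of_isUnramifiedAt_of_automorphicHalf
      fun hcpt σ π hπ v _ => ?_
    obtain ⟨χ, B, B', Λπ, Λπ', Γπ, Γπ', επ, c, hχI, hχF, hB, hΛπ, hΛπ', hΓπ, hΓπ', hYπ, -,
      hεπ, hεπ0, hc, hEπ, hEπ', hFπ, -, hdict⟩ := U hcpt σ π hπ v
    exact ⟨χ, B, B', Λπ, Λπ', Γπ, Γπ', επ, c, hχI, hχF, hB, hΛπ, hΛπ', hΓπ, hΓπ', hYπ, hεπ,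
      hεπ0, hc, hEπ, hEπ', hFπ, hdict⟩

end NamedFact

end Literature.NumberTheory.Automorphic

end
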